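import Literature.NumberTheory.Automorphic.AutomorphicRepsGL
import Literature.NumberTheory.GaloisRepresentations.ArtinLFunction
import HarnessLib
import HarnessLib.Audit

/-!
# Booker 2003: Artin's conjecture implies the strong Artin conjecture for `GL(2)` over `ℚ` (named fact)

A. R. Booker, *Poles of Artin L-functions and the strong Artin conjecture*, Ann. of Math. (2)
158 (2003), 1089–1098 [Booker2003], read at pp. 1089–1090 (held text
`paper:doi-10-4007-annals-2003-158-1089`, p. 2 of the materialised pages):

> "We may further assume that `ρ` is icosahedral, i.e. its image in `PGL₂(ℂ)` is isomorphic to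
> `A₅`, as all other 2-dimensional cases have been shown by Langlands [16] and Tunnell [19] to be
> automorphic. … **Theorem.** If some twist `L(s, ρ ⊗ χ)` of `L(s, ρ)` by a Dirichlet character
> `χ` has a pole then `L(s, ρ)` has infinitely many poles. Combining this with the `GL(2)`
> converse theorem [20], we have **Corollary.** If `L(s, ρ)` is not automorphic then it has
> infinitely many poles. In particular, the Artin conjecture for `ρ` implies the strong Artin
> conjecture for `ρ`."

Here `ρ : Gal(ℚ̄/ℚ) → GL₂(ℂ)` is a two-dimensional (continuous, irreducible, either parity —
"For brevity we will describe in detail the argument for even representations and give a summary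
of the differences in the odd case", p. 1090) complex Galois representation OVER `ℚ`; "the Artin
conjecture for `ρ`" = `L(s, ρ)` is entire (p. 1089: "Artin conjecture [1] asserts that `L(s, ρ)`
is entire, with the exception of a pole at `s = 1` if `ρ` is trivial"); "the strong Artin
conjecture for `ρ`" = `ρ` is automorphic, `L(s, ρ) = L(s, π)` for a cuspidal automorphic
representation `π` of `GL₂(𝔸_ℚ)` (p. 1089: "Langlands' modularity conjecture, also called the
strong Artin conjecture").

Vendored AS PRINTED (the "in particular" clause of the Corollary) as the named fact
`booker_strongArtin_of_artinConjecture`, over the tree's carriers: `σ : FramedArtinRep ℚ 2`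
(continuous `Γ_ℚ → GL₂(ℂ)`), irreducibility `σ.toGaloisRep.IsIrreducible`, "`L(s, σ)` entire" as
`GaloisRepresentations.LFunction.HasEntireContinuation (GaloisRepresentations.artinLFunction σ.toArtinRep)`
(the rendering already used for the "hence `L(ρ, s)` is entire" clauses of Langlands–Tunnell in
`Automorphic/LanglandsTunnellCases`), and "`π(σ)` exists" as `∃ hcpt π, π = π(σ)` in Tunnell's
a.e. sense — for all but finitely many finite places `v`, `π` has a Satake parameter `α` at `v`,
`σ` is unramified at `v`, and every ARITHMETIC Frobenius at `v` has characteristic polynomial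
`∏_{a ∈ α} (X - a) = satakePolynomial α` — which is implied by, hence at most as strong as, the
printed `L(s, ρ) = L(s, π)` (equal Euler products have equal Euler factors at every prime; the
tree's `artinLFunction` uses the same arithmetic-Frobenius Euler factors as `HasFrobCharpolyAt`).
The Theorem itself ("infinitely many poles") is not vendored (no meromorphic-continuation /
pole-counting vocabulary for Artin L-functions in the tree).

## Light module (revision 2, route request `EvenArtinQuantumBoundary`, item `BookerCriterion`)

The conclusion is the DEFINIENS of `Automorphic.IsPiOfArtinRep σ π.1`
(`∀ᶠ v in cofinite, FrobSatakeCompatibleAt σ π.1 v`, file `Automorphic/StrongArtinGL2`), written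
out so that this file imports only `Automorphic.AutomorphicRepsGL` and
`GaloisRepresentations.ArtinLFunction`: importing `StrongArtinGL2` would drag the Langlands–Tunnell
cone (`LanglandsTunnell(Proofs)`, `NewformGaloisRep`, `DedekindZeta`, …, with their unproved named
facts) into every route that cites Booker. Where `StrongArtinGL2` is imported the two forms agree
by `Iff.rfl` (`Automorphic.isPiOfArtinRep_iff`); the former sanity theorem
`booker_conclusion_of_isSolvable` (solvable image ⇒ conclusion, from `strongArtin_of_isSolvable`)
needs that import and is re-landed in the companion file `BookerStrongArtinSanity`.

Grounds `Summit.Langlands.Langlands.Theses.BianchiArtinPoints.StrongArtinEvenQ` (strong Artin for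
even irreducible `ρ : G_ℚ → GL₂` of finite image, the sector where "there are so far no known
examples in the even case", p. 1090) and `…EvenArtinQuantumBoundary.BookerCriterion`: those follow
from Artin's conjecture (holomorphy of `L(s, ρ)` alone, no twists) for even icosahedral `ρ`, after
the bridge between the summit's `ℓ`-adic finite-image carriers and the complex Artin carriers used
here — a bridge that is NOT part of this fact.
-/

noncomputable section

open scoped MatrixGroups NumberField
open NumberField IsDedekindDomain Literature.NumberTheory.Automorphic

namespace Literature.NumberTheory.Automorphic

/-- **Booker 2003, Corollary ("in particular" clause): Artin's conjecture for a two-dimensional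
`ρ` over `ℚ` implies the strong Artin conjecture for `ρ`.** Printed (Ann. of Math. 158 (2003),
p. 1090): "Corollary. If `L(s, ρ)` is not automorphic then it has infinitely many poles. In
particular, the Artin conjecture for `ρ` implies the strong Artin conjecture for `ρ`", for
`ρ : Gal(ℚ̄/ℚ) → GL₂(ℂ)` two-dimensional irreducible (icosahedral WLOG; the solvable types are
Langlands–Tunnell), of either parity. Rendered: for every continuous irreducible
`σ : Γ_ℚ → GL₂(ℂ)` whose Artin L-function `L(s, σ)` has an entire continuation, there are a
compactness witness `hcpt` and a cuspidal automorphic representation `π` of `GL₂(𝔸_ℚ)` with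
`π = π(σ)` in Tunnell's a.e. sense: for all but finitely many finite places `v`, `π` has a Satake
parameter `α` at `v`, `σ` is unramified at `v` and every arithmetic Frobenius at `v` has
characteristic polynomial `satakePolynomial α` (the definiens of `IsPiOfArtinRep σ π.1`; weaker
than the printed equality of L-functions). Base field `ℚ` only, as in print. Statement only.
[cite: Booker2003, Corollary (p. 1090)] -/
@[conjecture] def booker_strongArtin_of_artinConjecture : Prop :=
  ∀ (σ : GaloisRepresentations.FramedArtinRep ℚ 2), σ.toGaloisRep.IsIrreducible →
    GaloisRepresentations.LFunction.HasEntireContinuation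
        (GaloisRepresentations.artinLFunction σ.toArtinRep) →
      ∃ (hcpt : isCompact_glFiniteIntegralLevel 2 ℚ) (π : CuspidalAutomorphicRepData 2 ℚ hcpt),
        ∀ᶠ v : HeightOneSpectrum (𝓞 ℚ) in Filter.cofinite,
          ∃ α : Multiset ℂ, π.1.HasSatakeParamAt v α ∧ σ.IsUnramifiedAt v ∧
            σ.HasFrobCharpolyAt v (satakePolynomial α)


/-- **Booker 2003, Lemma 1 (meromorphic continuation of the additive twists).** Printed (Ann. of
Math. 158 (2003), p. 1092, in the section "Proof for even representations", for the irreducible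
two-dimensional `ρ : Gal(ℚ̄/ℚ) → GL₂(ℂ)` of the paper, with `L(s, ρ, α) := Σ_{n≥1} a_n e(−nα) n^{-s}`,
`a_n` the Dirichlet coefficients of `L(s, ρ)`, eq. (4) p. 1091): "**Lemma 1.** Let `α` be a
rational number. Then `L(s, ρ, α)` has meromorphic continuation to the complex plane, with poles
possible only in the strip `0 < Re s < 1`, and is expressible as the ratio of two entire functions
of order 1." Rendered over the tree's carriers for EVEN irreducible `σ : Γ_ℚ → GL₂(ℂ)`
(`det σ(c) = 1` at every complex conjugation, the section's standing parity; Booker's further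
"we may assume `ρ` icosahedral" is a without-loss reduction for his Theorem — the solvable types
being automorphic by Langlands–Tunnell — not a hypothesis of the Lemma, whose proof only uses that
every `L(s, ρ ⊗ χ₀)` is meromorphic with poles confined to the open critical strip): for every
coefficient sequence `a` with `Σ a_n n^{-s} = L(s, σ)` on `Re s > 1` (tree `artinLFunction`,
Mathlib `LSeries`) and every rational `α`, the additive twist `Σ a_n e(nα) n^{-s}` (the sign of
`α` is immaterial since `α` ranges over all rationals) agrees on `Re s > 1` with a function
meromorphic on `ℂ` and analytic at every `s` with `Re s ≤ 0` or `Re s ≥ 1`. The clause "ratio of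
two entire functions of order 1" is NOT rendered (no order-of-growth vocabulary is used
downstream). Grounds the existence of the regularised boundary values `D_a(0; x)` in
`Summit.Langlands.Langlands.Theses.EvenArtinQuantumBoundary.QuantumRigidity`,
`.GaloisBoundaryBounded` (its part (i)), `.BoundaryNecessity`, and the `k = 0` (indeed every
`k ≥ 0`) case of `.BoundaryValuesAlgebraic`. [cite: Booker2003, Lemma 1 (p. 1092)] -/
def booker_additiveTwist_meromorphic : Prop :=
  ∀ (σ : GaloisRepresentations.FramedArtinRep ℚ 2) (a : ℕ → ℂ), σ.toGaloisRep.IsIrreducible →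
    (∀ (φ : ℚ →+* ℝ) (c : Field.absoluteGaloisGroup ℚ),
      GaloisRepresentations.IsComplexConjugation φ c → Matrix.GeneralLinearGroup.det (σ c) = 1) →
    (∀ s : ℂ, 1 < s.re → LSeries a s = GaloisRepresentations.artinLFunction σ.toArtinRep s) →
    ∀ α : ℚ, ∃ D : ℂ → ℂ, MeromorphicOn D Set.univ ∧
      (∀ s : ℂ, s.re ≤ 0 ∨ 1 ≤ s.re → AnalyticAt ℂ D s) ∧
      ∀ s : ℂ, 1 < s.re →
        D s = LSeries (fun n : ℕ => a n * Complex.exp (2 * Real.pi * Complex.I * (n : ℂ) * ((α : ℚ) : ℂ))) s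

/-- Shape check: the vendored Lemma 1 yields, at `s = 0`, exactly the regularised-value witness
`∃ u, ∃ D, MeromorphicOn D univ ∧ AnalyticAt ℂ D 0 ∧ D 0 = u ∧ …` consumed by the route items of
`EvenArtinQuantumBoundary` (instantiate and read off `u := D 0`). [cite: Booker2003, Lemma 1 (p. 1092)] -/
theorem exists_regularisedValue_of_booker_additiveTwist_meromorphic
    (h : booker_additiveTwist_meromorphic)
    (σ : GaloisRepresentations.FramedArtinRep ℚ 2) (a : ℕ → ℂ) (hirr : σ.toGaloisRep.IsIrreducible)
    (heven : ∀ (φ : ℚ →+* ℝ) (c : Field.absoluteGaloisGroup ℚ),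
      GaloisRepresentations.IsComplexConjugation φ c → Matrix.GeneralLinearGroup.det (σ c) = 1)
    (ha : ∀ s : ℂ, 1 < s.re → LSeries a s = GaloisRepresentations.artinLFunction σ.toArtinRep s)
    (α : ℚ) :
    ∃ u : ℂ, ∃ D : ℂ → ℂ, MeromorphicOn D Set.univ ∧ AnalyticAt ℂ D 0 ∧ D 0 = u ∧
      ∀ s : ℂ, 1 < s.re →
        D s = LSeries (fun n : ℕ => a n * Complex.exp (2 * Real.pi * Complex.I * (n : ℂ) * ((α : ℚ) : ℂ))) s := by
  obtain ⟨D, hD, hA, hL⟩ := h σ a hirr heven ha α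
  exact ⟨D 0, D, hD, hA 0 (Or.inl (by simp)), rfl, hL⟩

end Literature.NumberTheory.Automorphic
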